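import Mathlib
import HarnessLib
import Summits.HubbardSuperconductivity.HubbardSuperconductivity.Theorems.KLProgrammeKLRegimeVolumeLimitTwoPointBareBound
import Summits.HubbardSuperconductivity.HubbardSuperconductivity.Theorems.KLProgrammeKLRegimeVolumeLimitTwoPointTimeH1OfC2

/-!
# Child `KLRegimeVolumeLimitV14` (stmt-HubbardSuperconductivity-19921), `stub_vl_bound`: the registered stub MODULO k3c5-p1's C2 ONLY
# (seat hubbard-kl-k3c5-p2, g4; technique «analytic-continuation-free assembly via FinalTwoLegVolLimit»)

Composition of the two finished halves of the (H1)-chain: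
* k3c4-p2's `tendsto_twoPoint_hamiltonian_of_C2` (p492690): for `L ≥ 3`, `0 < s < β`, every real `U`, the finite-`M` Grassmann two-point
  function converges to `e^{−βUL²/4}·Tr(e^{−(β−s)H′} c†_{x̄σ} e^{−sH′} c_{ȳσ′}) / Tr e^{−βH₀}` PROVIDED the pointwise free-trace identity C2
  (the `dΓ h`-trace of the two-time split-pair word equals `Z₀ · (−det Ẽ)`) holds at `(x, y, s)`;
* this seat's `stub_vl_bound_V14_of_H1` (p490789): that `Tendsto` clause at spins `(0,0)` for all `β > 0`, `U`, `μ`, `L ≥ 3`, `x`, `y`,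
  `s ∈ (0,β)` implies the registered text of `stub_vl_bound` (bare frame bound `|U|(2+β|U|)` via the re-amputated Hamiltonian self-energy,
  frame transfer by k3c5-p3's door p489301).
Hence **`stub_vl_bound_V14_of_C2`**: C2 at spins `(0,0)` (all `L ≥ 3`, `β > 0`, `μ`, `U`, sites, `s ∈ (0,β)`, generic two-block time
configurations, vertex sites) ⇒ `stub_vl_bound` verbatim.  The hypothesis is `tendsto_twoPoint_hamiltonian_of_C2`'s `hC2` with `σ = σ' = 0`,
quantified over the clause's parameters; nothing else is assumed.  Everything is proved; no definition.
-/

noncomputable section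

namespace Summit.HubbardSuperconductivity.HubbardSuperconductivity.Theorems.TwoPointAssembly

set_option linter.dupNamespace false -- summit = problem name (single-conjunct summit), D-0017

open MeasureTheory Finset NormedSpace Filter Topology Literature.MathematicalPhysics.QuantumLattice Literature.Probability.LatticeModels
open Summit.HubbardSuperconductivity.HubbardSuperconductivity.Theorems.KLRegimeSplit
open Summit.HubbardSuperconductivity.HubbardSuperconductivity.Theorems.KLProgrammeLegKernels
open Summit.HubbardSuperconductivity.HubbardSuperconductivity.Theorems.MatsubaraAllU
open scoped Nat ComplexOrder

/-- **`stub_vl_bound` of 19921 MODULO C2 (spins `(0,0)`).**  If, for every `L ≥ 3`, `β > 0`, real `μ, U`, torus sites `xe, ye`, `s ∈ (0,β)`,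
every generic two-block time configuration `u` (in `(0,(β−s)/β)`), `u'` (in `(0,s/β)`) and all vertex sites `f ⧺ f'`, the free trace of the
two-time split-pair word equals `Z₀ · (−det Ẽ)` (k3c5-p1's C2 in the letters of `tendsto_twoPoint_hamiltonian_of_C2`), then the registered
text of `stub_vl_bound` (`KLRegimeVolumeLimitV14`, skeleton «cauchy») holds. -/
theorem stub_vl_bound_V14_of_C2
    (hC2 : ∀ (L : ℕ) [NeZero L], 3 ≤ L → ∀ β : ℝ, 0 < β → ∀ (μ U : ℝ) (xe ye : TorusSite 2 L) (s : ℝ), s ∈ Set.Ioo (0 : ℝ) β →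
      ∀ (k j : ℕ) (u : Fin k → ℝ) (u' : Fin j → ℝ), StrictMono u → StrictMono u' →
      (∀ i, u i ∈ Set.Ioo (0 : ℝ) ((β - s) / β)) → (∀ l, u' l ∈ Set.Ioo (0 : ℝ) (s / β)) →
      ∀ (f : Fin k → FermionTorus 2 L) (f' : Fin j → FermionTorus 2 L),
        (Matrix.gibbsWeight β (dGamma (hubbardOneBody (fermionTorusGraph 2 L) 1 μ)) * (annihilation (orb (FermionTorus.ofTorusSite ye) 0) *
                ((List.ofFn fun i : Fin k =>
                    ((exp ((((u i : ℝ) : ℂ) * -(β : ℂ)) • dGamma (hubbardOneBody (fermionTorusGraph 2 L) 1 μ)) * creation (orb (f i) 0) *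
                          exp (-((((u i : ℝ) : ℂ) * -(β : ℂ)) • dGamma (hubbardOneBody (fermionTorusGraph 2 L) 1 μ)))) *
                        (exp ((((u i : ℝ) : ℂ) * -(β : ℂ)) • dGamma (hubbardOneBody (fermionTorusGraph 2 L) 1 μ)) * annihilation (orb (f i) 0) *
                          exp (-((((u i : ℝ) : ℂ) * -(β : ℂ)) • dGamma (hubbardOneBody (fermionTorusGraph 2 L) 1 μ)))) -
                      ((1 / 2 : ℝ) : ℂ) • (1 : Matrix (Finset (Orb (FermionTorus 2 L))) (Finset (Orb (FermionTorus 2 L))) ℂ)) *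
                    ((exp ((((u i : ℝ) : ℂ) * -(β : ℂ)) • dGamma (hubbardOneBody (fermionTorusGraph 2 L) 1 μ)) * creation (orb (f i) 1) *
                          exp (-((((u i : ℝ) : ℂ) * -(β : ℂ)) • dGamma (hubbardOneBody (fermionTorusGraph 2 L) 1 μ)))) *
                        (exp ((((u i : ℝ) : ℂ) * -(β : ℂ)) • dGamma (hubbardOneBody (fermionTorusGraph 2 L) 1 μ)) * annihilation (orb (f i) 1) *
                          exp (-((((u i : ℝ) : ℂ) * -(β : ℂ)) • dGamma (hubbardOneBody (fermionTorusGraph 2 L) 1 μ)))) -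
                      ((1 / 2 : ℝ) : ℂ) • (1 : Matrix (Finset (Orb (FermionTorus 2 L))) (Finset (Orb (FermionTorus 2 L))) ℂ))).prod *
                  (exp (((((β - s) / β : ℝ) : ℂ) * -(β : ℂ)) • dGamma (hubbardOneBody (fermionTorusGraph 2 L) 1 μ)) * creation (orb (FermionTorus.ofTorusSite xe) 0) *
                    exp (-(((((β - s) / β : ℝ) : ℂ) * -(β : ℂ)) • dGamma (hubbardOneBody (fermionTorusGraph 2 L) 1 μ)))) *
                  (List.ofFn fun l : Fin j =>
                    ((exp ((((((β - s) / β + u' l : ℝ) : ℂ)) * -(β : ℂ)) • dGamma (hubbardOneBody (fermionTorusGraph 2 L) 1 μ)) * creation (orb (f' l) 0) *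
                          exp (-((((((β - s) / β + u' l : ℝ) : ℂ)) * -(β : ℂ)) • dGamma (hubbardOneBody (fermionTorusGraph 2 L) 1 μ)))) *
                        (exp ((((((β - s) / β + u' l : ℝ) : ℂ)) * -(β : ℂ)) • dGamma (hubbardOneBody (fermionTorusGraph 2 L) 1 μ)) *
                            annihilation (orb (f' l) 0) *
                          exp (-((((((β - s) / β + u' l : ℝ) : ℂ)) * -(β : ℂ)) • dGamma (hubbardOneBody (fermionTorusGraph 2 L) 1 μ)))) -
                      ((1 / 2 : ℝ) : ℂ) • (1 : Matrix (Finset (Orb (FermionTorus 2 L))) (Finset (Orb (FermionTorus 2 L))) ℂ)) *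
                    ((exp ((((((β - s) / β + u' l : ℝ) : ℂ)) * -(β : ℂ)) • dGamma (hubbardOneBody (fermionTorusGraph 2 L) 1 μ)) * creation (orb (f' l) 1) *
                          exp (-((((((β - s) / β + u' l : ℝ) : ℂ)) * -(β : ℂ)) • dGamma (hubbardOneBody (fermionTorusGraph 2 L) 1 μ)))) *
                        (exp ((((((β - s) / β + u' l : ℝ) : ℂ)) * -(β : ℂ)) • dGamma (hubbardOneBody (fermionTorusGraph 2 L) 1 μ)) *
                            annihilation (orb (f' l) 1) *
                          exp (-((((((β - s) / β + u' l : ℝ) : ℂ)) * -(β : ℂ)) • dGamma (hubbardOneBody (fermionTorusGraph 2 L) 1 μ)))) -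
                      ((1 / 2 : ℝ) : ℂ) • (1 : Matrix (Finset (Orb (FermionTorus 2 L))) (Finset (Orb (FermionTorus 2 L))) ℂ))).prod))).trace =
          Matrix.partitionFn β (dGamma (hubbardOneBody (fermionTorusGraph 2 L) 1 μ)) * -(Matrix.of (Fin.cases
          (Fin.cases
            (-(exp (-((0 : ℂ) • hubbardOneBody (fermionTorusGraph 2 L) 1 μ)) *
                (1 + exp (-((β : ℂ) • hubbardOneBody (fermionTorusGraph 2 L) 1 μ)))⁻¹ *
                exp (((((β - s) / β : ℝ) : ℂ) * -(β : ℂ)) • hubbardOneBody (fermionTorusGraph 2 L) 1 μ))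
              (orb (FermionTorus.ofTorusSite ye) 0) (orb (FermionTorus.ofTorusSite xe) 0))
            (fun m' : Fin ((k + j) * 2) =>
              if k ≤ ((finProdFinEquiv.symm m' : Fin (k + j) × Fin 2).1 : ℕ) then
                (exp (-((((Fin.append u (fun l => (β - s) / β + u' l) (finProdFinEquiv.symm m' : Fin (k + j) × Fin 2).1 : ℝ) : ℂ) *
                      -(β : ℂ)) • hubbardOneBody (fermionTorusGraph 2 L) 1 μ)) *
                    (1 + exp ((β : ℂ) • hubbardOneBody (fermionTorusGraph 2 L) 1 μ))⁻¹ *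
                    exp (((((β - s) / β : ℝ) : ℂ) * -(β : ℂ)) • hubbardOneBody (fermionTorusGraph 2 L) 1 μ))
                  (orb (FermionTorus.ofTorusSite (FermionTorus.toTorusSite (Fin.append f f' (finProdFinEquiv.symm m' : Fin (k + j) × Fin 2).1)))
                    (finProdFinEquiv.symm m' : Fin (k + j) × Fin 2).2) (orb (FermionTorus.ofTorusSite xe) 0)
              else
                -(exp (-((((Fin.append u (fun l => (β - s) / β + u' l) (finProdFinEquiv.symm m' : Fin (k + j) × Fin 2).1 : ℝ) : ℂ) *
                      -(β : ℂ)) • hubbardOneBody (fermionTorusGraph 2 L) 1 μ)) *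
                    (1 + exp (-((β : ℂ) • hubbardOneBody (fermionTorusGraph 2 L) 1 μ)))⁻¹ *
                    exp (((((β - s) / β : ℝ) : ℂ) * -(β : ℂ)) • hubbardOneBody (fermionTorusGraph 2 L) 1 μ))
                  (orb (FermionTorus.ofTorusSite (FermionTorus.toTorusSite (Fin.append f f' (finProdFinEquiv.symm m' : Fin (k + j) × Fin 2).1)))
                    (finProdFinEquiv.symm m' : Fin (k + j) × Fin 2).2) (orb (FermionTorus.ofTorusSite xe) 0)))
          (fun m : Fin ((k + j) * 2) => Fin.cases
            (-(exp (-((0 : ℂ) • hubbardOneBody (fermionTorusGraph 2 L) 1 μ)) *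
                (1 + exp (-((β : ℂ) • hubbardOneBody (fermionTorusGraph 2 L) 1 μ)))⁻¹ *
                exp ((((Fin.append u (fun l => (β - s) / β + u' l) (finProdFinEquiv.symm m : Fin (k + j) × Fin 2).1 : ℝ) : ℂ) *
                  -(β : ℂ)) • hubbardOneBody (fermionTorusGraph 2 L) 1 μ))
              (orb (FermionTorus.ofTorusSite ye) 0)
              (orb (FermionTorus.ofTorusSite (FermionTorus.toTorusSite (Fin.append f f' (finProdFinEquiv.symm m : Fin (k + j) × Fin 2).1)))
                (finProdFinEquiv.symm m : Fin (k + j) × Fin 2).2))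
            (fun m' : Fin ((k + j) * 2) =>
              twoPointWordMatrix L β μ 0 0 xe ye (fun a => FermionTorus.toTorusSite (Fin.append f f' a)) (Fin.append u (fun l => (β - s) / β + u' l)) m.succ m'.succ)) :
          Fin ((k + j) * 2 + 1) → Fin ((k + j) * 2 + 1) → ℂ)).det) :
    ∀ (G : GeoConsts) (P : SplitConsts) (Q : EngConsts) (R : RenConsts), G.WF → P.WF → Q.WF → R.WF →
      ∃ c₅ : ℝ, 0 < c₅ ∧ ∀ c : ℝ, 0 < c → c ≤ c₅ → ∃ U₀ : ℝ, 0 < U₀ ∧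
        ∀ μ ∈ klWindowC, ∀ U : ℝ, 0 < U → U ≤ U₀ → ∀ β : ℝ, klBetaMin ≤ β → β ≤ Real.exp (c / U ^ 2) →
          ∀ K : TrigPolyC4v, klPredsV14.frameOK R U (nScales β) μ K →
            ∀ (Lstar : ℕ) (Mstar : ℕ → ℕ), TowerP klPredsV14 G P Q R β U μ K Lstar Mstar →
              ∃ B : ℝ, ∃ L₀ : ℕ, ∃ Mth : ℕ → ℕ, ∀ (L : ℕ) [NeZero L], L₀ ≤ L → ∀ (M : ℕ) [NeZero M], Mth L ≤ M →
                ∀ (k : FreqMomentum L M) (σ : Fin 2), ‖klSelfEnergy L M β U μ K klE0 (nScales β + 1) k σ‖ ≤ B :=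
  stub_vl_bound_V14_of_H1 fun β hβ U μ L _ hL x y s hs =>
    tendsto_twoPoint_hamiltonian_of_C2 hL hβ μ U 0 0 x y hs (hC2 L hL β hβ μ U x y s hs)

end Summit.HubbardSuperconductivity.HubbardSuperconductivity.Theorems.TwoPointAssembly

end
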